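import Literature.MathematicalPhysics.QuantumFieldTheory.Balaban1983to89.Node00.Record9ProvisosOfRegularity
import Literature.MathematicalPhysics.QuantumFieldTheory.Balaban1983to89.Node00.Record10

/-!
# NODE 00 — THE K0 REDUCTION AT STAGE 10 (`_₁₀` twin of `Node00/Record9ProvisosOfRegularity`): `Stage9Params.Provisos₁₀` of the delta
# extension from the SAME four displayed regularity clauses, read along the Stage-10 histories, plus def-T's displayed β-version proviso `contT`

Cell `pub-ymgap`, seat `pub-ymgap-dag-n23-b` g3.  `Record10` (def-T, p429207) restates Record9's six provisos along `gOfRecord₁₀` ∕ `EOfRecord₁₀`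
(the histories generated by `betaOfRecord₁₀ = betaOfRecord₉c`) and adds `contT : θ.toStage8Params.HasContTransportAlong`.  The level induction of
`Record9ProvisosOfRegularity` §1 is history-generic, so the reduction transports by ONE substitution; `contT` is passed through (the tower does not
read it).  [III] = [Balaban1988Convergent], [IV] = [Balaban1989LargeFieldI].

* `provisos₁₀_stage9DeltaOfRecord_of_regularity` — `Provisos₁₀` of `stage9DeltaOfRecord θ₈` from (H-χ)₁₀, (H-ω)₁₀, (H-h), (H-supp)₁₀ (the four
  clauses of the ₉ file, keyed to `gOfRecord₁₀`) and (H-contT) `θ₈.HasContTransportAlong`;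
* `exists_isRecordOfRecord₁₀C_of_regularity` — with an admissible charted `θ₈`, a Stage-10 record exists (def-T's `exists_world_isRecordOfRecord₁₀C`).

## HONEST FRAMING — what this is NOT

* A REDUCTION with FIVE displayed hypotheses, none asserted: (H-χ)₁₀, (H-ω)₁₀, (H-supp)₁₀ are statements about `Classical.choose`-defined objects,
  (H-h) about an `rnDeriv` representative (the seat's `K0-TYPING-CENSUS.md` §2), (H-contT) is FILE 4's located existence hypothesis (plan (c1),
  RIDER №6 (b)).  K0's ₁₀∕₁₁ successor at `F 2` is NOT discharged here; nothing of Bałaban's is asserted; no node count moves.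
* One finite four-torus programme at fixed `ε` — NOT the continuum limit on ℝ⁴, NOT infinite volume, NOT OS, NOT a mass gap, NOT the Clay problem.
-/

noncomputable section

open MeasureTheory ProbabilityTheory
open scoped BigOperators NNReal ENNReal

namespace Literature.MathematicalPhysics.QuantumFieldTheory.Balaban1983to89.Node00

open T4Continuum B14.Eq218Concrete T4AveragingDisintegration T4FiniteEpsInhabited
open B15.BasicStep (fibreIntegral)
open DagBinding (WorldP)

variable (F : T4Family) (N : ℕ) [NeZero N]

/-- **K0 AT STAGE 10 REDUCED TO FOUR DISPLAYED REGULARITY CLAUSES + `contT` (every `N`)**: the delta extension `stage9DeltaOfRecord θ₈` satisfies def-T's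
`Stage9Params.Provisos₁₀` provided (H-χ)₁₀ every `χ_k(s)` of record along the Stage-10 histories is measurable, (H-ω)₁₀ the label weights `ω` of record
are jointly measurable, (H-h) the marginal density of the averaging transport of record is pointwise bounded, (H-supp)₁₀ the support-form (0.3) clause
holds for the pre-𝐑 pieces at `Z″ := Z`, and (H-contT) the β-layer transforms admit continuous versions (def-T's FILE 4 `Stage8Params.HasContTransportAlong`, `Node00/ContinuousTransportOfRecord`, consumed BY NAME — as `Record10.Provisos₁₀.contT` and n26-a's `…N26TransportGeneric` read it).  `intPiece` (every level), the two ζ-laws and the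
measurability ∕ sign ∕ bound conjuncts of `rstep` DROP OUT (§1 of the ₉ file, history-generic).  All five are DISPLAYED HYPOTHESES, never asserted.
[cite: Balaban1988Convergent, (2.18) p.257, (3.1)–(3.9) pp.264–266, (3.16) p.268, (3.24)–(3.25) p.270; Balaban1989LargeFieldI, (0.3)–(0.4) p.176; Balaban1987RG1, (0.13) p.254, (0.19) p.255 (the provisos reduced; bookkeeping)] -/
theorem provisos₁₀_stage9DeltaOfRecord_of_regularity (θ₈ : Stage8Params F N)
    (hχ : ∀ (p : B12.RunParams) (k : ℕ) (s : SeqOfRecord F θ₈.ν 1 (gOfRecord₁₀ F N (stage9DeltaOfRecord F N θ₈) p) p.K k),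
      Measurable (chiSeqOfRecord F N θ₈.ν 1 (gOfRecord₁₀ F N (stage9DeltaOfRecord F N θ₈) p) p.K k s))
    (hω : ∀ (p : B12.RunParams) (k : ℕ) (s : SeqOfRecord F θ₈.ν 1 (gOfRecord₁₀ F N (stage9DeltaOfRecord F N θ₈) p) p.K k)
      (t : LbOfRecord F θ₈.ν p (gOfRecord₁₀ F N (stage9DeltaOfRecord F N θ₈) p) k),
      Measurable (fun z : GaugeField (F.P p.K) (k + 1) (SU N) × GaugeField (F.P p.K) k (SU N) =>
        ωOfRecord F N θ₈.ν 1 p (gOfRecord₁₀ F N (stage9DeltaOfRecord F N θ₈) p) k 0 (zetaDeltaOfRecord F N θ₈.ν 1) s t z.2 z.1))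
    (hh : ∀ K k : ℕ, ∃ C : ℝ, ∀ V', (avgDensity (avOfRecord F N K k).avg V' : ℝ) ≤ C)
    (hsupp : ∀ (p : B12.RunParams) (k : ℕ) [DecidableEq (PBond (F.P p.K) (k + 1))]
      (s : SeqOfRecord F θ₈.ν 1 (gOfRecord₁₀ F N (stage9DeltaOfRecord F N θ₈) p) p.K (k + 1)) (V : GaugeField (F.P p.K) (k + 1) (SU N)),
      fibreIntegral (fibOfSeq F θ₈.ν ⟨1, 0, 0⟩ p (gOfRecord₁₀ F N (stage9DeltaOfRecord F N θ₈) p) (k + 1) s)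
        (fun V => chiSeqOfRecord F N θ₈.ν 1 (gOfRecord₁₀ F N (stage9DeltaOfRecord F N θ₈) p) p.K (k + 1) s V *
          slotsTOfRecord F N θ₈.ν ⟨1, 0, 0⟩ (EOfRecord₁₀ F N (stage9DeltaOfRecord F N θ₈)) (wOfRecord₉ F N (stage9DeltaOfRecord F N θ₈))
            (ppSelIdOfRecord F θ₈.ν 1) p (gOfRecord₁₀ F N (stage9DeltaOfRecord F N θ₈) p) (k + 1) s V) V = 0 →
      chiSeqOfRecord F N θ₈.ν 1 (gOfRecord₁₀ F N (stage9DeltaOfRecord F N θ₈) p) p.K (k + 1) s V *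
        slotsTOfRecord F N θ₈.ν ⟨1, 0, 0⟩ (EOfRecord₁₀ F N (stage9DeltaOfRecord F N θ₈)) (wOfRecord₉ F N (stage9DeltaOfRecord F N θ₈))
          (ppSelIdOfRecord F θ₈.ν 1) p (gOfRecord₁₀ F N (stage9DeltaOfRecord F N θ₈) p) (k + 1) s V = 0)
    (hcontT : θ₈.HasContTransportAlong) :
    (stage9DeltaOfRecord F N θ₈).Provisos₁₀ := by
  have hw : ∀ (p : B12.RunParams) (k : ℕ) (s' : SeqOfRecord F θ₈.ν 1 (gOfRecord₁₀ F N (stage9DeltaOfRecord F N θ₈) p) p.K (k + 1)),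
      Measurable (fun z : GaugeField (F.P p.K) (k + 1) (SU N) × GaugeField (F.P p.K) k (SU N) =>
        wOfRecord₉ F N (stage9DeltaOfRecord F N θ₈) p (gOfRecord₁₀ F N (stage9DeltaOfRecord F N θ₈) p) k s' z.2 z.1) :=
    fun p k s' => measurable_wOfRecord F N θ₈.ν 1 0 (zetaDeltaOfRecord F N θ₈.ν 1) p _ k (hω p k) s'
  have hwb : ∀ (p : B12.RunParams) (k : ℕ) s' U V',
      |wOfRecord₉ F N (stage9DeltaOfRecord F N θ₈) p (gOfRecord₁₀ F N (stage9DeltaOfRecord F N θ₈) p) k s' U V'| ≤ 1 :=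
    fun p k s' U V' => abs_wOfRecord_le_one F N θ₈.ν 1 0 (isZetaAbsLeOne_zetaDeltaOfRecord F N θ₈.ν 1) p _ k s' U V'
  have hw0 := wOfRecord₉_stage9DeltaOfRecord_nonneg F N θ₈
  have hreg := fun p => slotsOfRecord_measurable_and_bounded F N θ₈.ν ⟨1, 0, 0⟩ (p := p) (EOfRecord₁₀ F N (stage9DeltaOfRecord F N θ₈))
    (hw p) (hwb p) hw0 (hχ p) (fun k => hh p.K k)
  have hregT := fun p => slotsTOfRecord_measurable_and_bounded F N θ₈.ν ⟨1, 0, 0⟩ (p := p) (EOfRecord₁₀ F N (stage9DeltaOfRecord F N θ₈))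
    (hw p) (hwb p) hw0 (hχ p) (fun k => hh p.K k)
  refine ⟨fun p k _ s => ?_, fun p k _ s t => hω p k s t, fun p k _ s' => hχ p (k + 1) s',
    isZetaUnity_zetaDeltaOfRecord F N θ₈.ν 1, isZetaAbsLeOne_zetaDeltaOfRecord F N θ₈.ν 1, fun p k _ hk => ?_, hcontT⟩
  · obtain ⟨hm, C, hC⟩ := hreg p k
    show Integrable (fun U => chiSeqOfRecord F N θ₈.ν 1 (gOfRecord₁₀ F N (stage9DeltaOfRecord F N θ₈) p) p.K k s U *
        slotsOfRecord F N θ₈.ν ⟨1, 0, 0⟩ (EOfRecord₁₀ F N (stage9DeltaOfRecord F N θ₈)) (wOfRecord₉ F N (stage9DeltaOfRecord F N θ₈))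
          (ppSelIdOfRecord F θ₈.ν 1) p (gOfRecord₁₀ F N (stage9DeltaOfRecord F N θ₈) p) k s U) (fieldMeasure (F.P p.K) k (SU N))
    have h0 : ∀ U, 0 ≤ chiSeqOfRecord F N θ₈.ν 1 (gOfRecord₁₀ F N (stage9DeltaOfRecord F N θ₈) p) p.K k s U *
        slotsOfRecord F N θ₈.ν ⟨1, 0, 0⟩ (EOfRecord₁₀ F N (stage9DeltaOfRecord F N θ₈)) (wOfRecord₉ F N (stage9DeltaOfRecord F N θ₈))
          (ppSelIdOfRecord F θ₈.ν 1) p (gOfRecord₁₀ F N (stage9DeltaOfRecord F N θ₈) p) k s U :=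
      fun U => mul_nonneg (chiSeqOfRecord_nonneg F N θ₈.ν 1 _ p.K k s U) (slotsOfRecord_nonneg F N θ₈.ν ⟨1, 0, 0⟩ _ hw0 _ p _ k s U)
    refine (integrable_const C).mono' (((hχ p k s).mul (hm s)).aestronglyMeasurable) (ae_of_all _ fun U => ?_)
    rw [Real.norm_eq_abs, abs_of_nonneg (h0 U)]
    exact (mul_le_of_le_one_left (slotsOfRecord_nonneg F N θ₈.ν ⟨1, 0, 0⟩ _ hw0 _ p _ k s U)
      (chiSeqOfRecord_le_one F N θ₈.ν 1 _ p.K k s U)).trans (hC s U)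
  · obtain ⟨hmT, C, hC⟩ := hregT p k
    have hT0 : ∀ s V, 0 ≤ slotsTOfRecord F N θ₈.ν ⟨1, 0, 0⟩ (EOfRecord₁₀ F N (stage9DeltaOfRecord F N θ₈)) (wOfRecord₉ F N (stage9DeltaOfRecord F N θ₈))
        (ppSelIdOfRecord F θ₈.ν 1) p (gOfRecord₁₀ F N (stage9DeltaOfRecord F N θ₈) p) (k + 1) s V :=
      slotsTOfRecord_nonneg F N θ₈.ν ⟨1, 0, 0⟩ _ hw0 _ p _ (k + 1)
    refine (provisosSupp_towerRepOfRecord_iff F N θ₈.ν ⟨1, 0, 0⟩ _ _ p _ (k + 1)).2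
      ⟨fun s => (hχ p (k + 1) s).mul (hmT s),
        fun s V => piece_slotsTOfRecord_nonneg F N θ₈.ν ⟨1, 0, 0⟩ _ hw0 _ p _ (k + 1) s V, ⟨C, fun s V => ?_⟩,
        fun s V h => hsupp p k s V h⟩
    exact (mul_le_of_le_one_left (hT0 s V) (chiSeqOfRecord_le_one F N θ₈.ν 1 _ p.K (k + 1) s V)).trans (hC s V)

/-- **A STAGE-10 RECORD EXISTS AT EVERY `N` GIVEN THE FIVE CLAUSES** at the delta extension of an admissible Stage-8 parameter carrying the chart clause of
record (def-T's `exists_world_isRecordOfRecord₁₀C` at the reduced provisos).  A REDUCTION: the clauses are displayed hypotheses, none asserted; K0's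
₁₀∕₁₁ successor (plan: at `F 2`) is NOT discharged here. [cite: Balaban1989LargeFieldII, Thm 1 + (0.1) pp.355–356; Balaban1989LargeFieldI, (0.3)–(0.4) p.176 (bookkeeping)] -/
theorem exists_isRecordOfRecord₁₀C_of_regularity (θ₈ : Stage8Params F N) (hθ : θ₈.Admissible) (hch : θ₈.IsChartOfRecord 1)
    (hχ : ∀ (p : B12.RunParams) (k : ℕ) (s : SeqOfRecord F θ₈.ν 1 (gOfRecord₁₀ F N (stage9DeltaOfRecord F N θ₈) p) p.K k),
      Measurable (chiSeqOfRecord F N θ₈.ν 1 (gOfRecord₁₀ F N (stage9DeltaOfRecord F N θ₈) p) p.K k s))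
    (hω : ∀ (p : B12.RunParams) (k : ℕ) (s : SeqOfRecord F θ₈.ν 1 (gOfRecord₁₀ F N (stage9DeltaOfRecord F N θ₈) p) p.K k)
      (t : LbOfRecord F θ₈.ν p (gOfRecord₁₀ F N (stage9DeltaOfRecord F N θ₈) p) k),
      Measurable (fun z : GaugeField (F.P p.K) (k + 1) (SU N) × GaugeField (F.P p.K) k (SU N) =>
        ωOfRecord F N θ₈.ν 1 p (gOfRecord₁₀ F N (stage9DeltaOfRecord F N θ₈) p) k 0 (zetaDeltaOfRecord F N θ₈.ν 1) s t z.2 z.1))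
    (hh : ∀ K k : ℕ, ∃ C : ℝ, ∀ V', (avgDensity (avOfRecord F N K k).avg V' : ℝ) ≤ C)
    (hsupp : ∀ (p : B12.RunParams) (k : ℕ) [DecidableEq (PBond (F.P p.K) (k + 1))]
      (s : SeqOfRecord F θ₈.ν 1 (gOfRecord₁₀ F N (stage9DeltaOfRecord F N θ₈) p) p.K (k + 1)) (V : GaugeField (F.P p.K) (k + 1) (SU N)),
      fibreIntegral (fibOfSeq F θ₈.ν ⟨1, 0, 0⟩ p (gOfRecord₁₀ F N (stage9DeltaOfRecord F N θ₈) p) (k + 1) s)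
        (fun V => chiSeqOfRecord F N θ₈.ν 1 (gOfRecord₁₀ F N (stage9DeltaOfRecord F N θ₈) p) p.K (k + 1) s V *
          slotsTOfRecord F N θ₈.ν ⟨1, 0, 0⟩ (EOfRecord₁₀ F N (stage9DeltaOfRecord F N θ₈)) (wOfRecord₉ F N (stage9DeltaOfRecord F N θ₈))
            (ppSelIdOfRecord F θ₈.ν 1) p (gOfRecord₁₀ F N (stage9DeltaOfRecord F N θ₈) p) (k + 1) s V) V = 0 →
      chiSeqOfRecord F N θ₈.ν 1 (gOfRecord₁₀ F N (stage9DeltaOfRecord F N θ₈) p) p.K (k + 1) s V *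
        slotsTOfRecord F N θ₈.ν ⟨1, 0, 0⟩ (EOfRecord₁₀ F N (stage9DeltaOfRecord F N θ₈)) (wOfRecord₉ F N (stage9DeltaOfRecord F N θ₈))
          (ppSelIdOfRecord F θ₈.ν 1) p (gOfRecord₁₀ F N (stage9DeltaOfRecord F N θ₈) p) (k + 1) s V = 0)
    (hcontT : θ₈.HasContTransportAlong) :
    ∃ (D : T4Continuum.FiniteEpsData F (SU N)) (w : WorldP), IsRecordOfRecord₁₀C F N D w ∧ w.γ = θ₈.γ := by
  obtain ⟨w, hw, hwγ⟩ := exists_world_isRecordOfRecord₁₀C F N (stage9DeltaOfRecord F N θ₈)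
    (provisos₁₀_stage9DeltaOfRecord_of_regularity F N θ₈ hχ hω hh hsupp hcontT) (admissible_stage9DeltaOfRecord F N hθ hch)
    (γw := θ₈.γ) ⟨hθ.1.1.2, le_rfl⟩
  exact ⟨_, w, hw, hwγ⟩

end Literature.MathematicalPhysics.QuantumFieldTheory.Balaban1983to89.Node00

end
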